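import Literature.Analysis.FluidPDE.LinearisedNSFourierForcedDefs
import Literature.Analysis.FluidPDE.LinearisedNSFourierIteration
import HarnessLib

/-!
# The forced Duhamel map of the linearised Navier–Stokes equation with a source: basic properties

Analysis/FluidPDE proof file, second of the files `LinearisedNSFourierForced*` (objects in
`LinearisedNSFourierForcedDefs`), the inhomogeneous twin of `LinearisedNSFourierPicard`. For
Fourier-side data `(ν, T, U, G, a)` under `PicardHypF` (viscosity `ν > 0`, drift coefficients
`Uⱼ(t)`, source coefficients `Gⱼ(t)`, datum `a`; every polynomial decay, continuity in time)
the mild form of the projected forced linearised equation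
`∂ₜcₗ = -νₖ cₗ - (P linSym)(U, c)ₗ + (P G)ₗ`, `νₖ = 4π²ν|k|²`, is the fixed-point equation
`c = Φ_G(c) = Φ(c) + forcing`, with `Φ = picardMap ν T U a` the homogeneous Duhamel map
(`LinearisedNSFourierDefs`) and the forcing term
`forcing ν T G (l,t,k) = ∫₀^τ e^{-νₖ(τ-s)} (P G(s))ₗ(k) ds`, `τ = clamp T t`, which does not
depend on the unknown (Constantin–Foias 1988, Ch. 14, (14.3) with an inhomogeneity; the source
enters exactly as `S` in `ScalarFourier.picardMap`). This file provides:

* continuity in time of the forcing term and of `Φ_G(c)` (`PicardHypF.continuous_forcing`,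
  `PicardHypF.continuous_picardMapF`; parametric interval integrals), decay of the projected
  source and of the forcing term (`hasDecay_srcProj`, `hasDecay_forcing`: the heat factor is at
  most one, `ScalarFourier.norm_duhamel_le_const`), the first iterate
  `Φ_G(0) = e^{-νₖτ}a + forcing` and its decay (`picardMapF_zero_field`,
  `PicardHypF.hasDecay_picardMapF_zero`);
* **the key identity `Φ_G(c₁) - Φ_G(c₂) = Φ(c₁) - Φ(c₂)`** (`picardMapF_sub`,
  `picardIterF_succ_sub`): the contraction estimate `PicardHyp.exists_contraction` of the
  homogeneous map applies verbatim to the forced iteration;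
* the datum `Φ_G(c)(l, 0, k) = a(l, k)` (`picardMapF_zero_time`);
* structure: the forcing term is Fourier-divergence free, `∑ₗ kₗ forcing(l,t,k) = 0`
  (`sum_intCast_mul_leray_apply`), hence so is `Φ_G(c)` for a Fourier-divergence-free datum
  (`PicardHypF.sum_intCast_mul_picardMapF`); and the forcing term has vanishing zero mode when
  the source has (`forcing_zero_freq`: `P(0) = 1`).

## References

* P. Constantin, C. Foias, *Navier–Stokes Equations*, Univ. Chicago Press 1988, Ch. 14, (14.3)–(14.4). [`ConstantinFoiasNSE1988`]
* P. G. Lemarié-Rieusset, *The Navier–Stokes problem in the 21st century*, CRC 2016, §6.1, §8.5.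
-/

noncomputable section

open MeasureTheory Real Set Filter Topology UnitAddTorus intervalIntegral

namespace Literature.Analysis.FluidPDE

namespace LinearisedNSFourier

open ScalarFourier
open CorrectorFourier (leraySym)
open FourierNS (HasDecay clamp)
open Literature.Analysis.FunctionSpaces.Torus (freqNormSq)

variable {d : Type*} [Fintype d] [DecidableEq d]
variable {ν T : ℝ} {U G : d → ℝ → (d → ℤ) → ℂ} {a : d → (d → ℤ) → ℂ}

/-! ### Constants, continuity, decay -/

section Basic

omit [DecidableEq d] in
/-- Nonnegative uniform decay constants of the source coefficients. [folklore] -/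
theorem PicardHypF.decayG_nonneg [DecidableEq d] (h : PicardHypF ν T U G a) (K : ℕ) :
    ∃ B : ℝ, 0 ≤ B ∧ ∀ j t, HasDecay K B (G j t) := by
  obtain ⟨B, hB⟩ := h.decayG K
  exact ⟨max B 0, le_max_right _ _, fun j t => (hB j t).mono (le_max_left _ _)⟩

/-- **Decay of the projected source**: the projector costs the factor `2#d`
(`hasDecay_leray_apply`). [folklore] -/
theorem hasDecay_srcProj {K : ℕ} {B : ℝ} {G₀ : d → (d → ℤ) → ℂ} (hB : ∀ m, HasDecay K B (G₀ m))
    (l : d) : HasDecay K (2 * Fintype.card d * B) (srcProj G₀ l) := fun k =>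
  hasDecay_leray_apply (G := G₀) hB l k

/-- The projected source is continuous in time at each component and frequency. [folklore] -/
theorem PicardHypF.continuous_srcProj (h : PicardHypF ν T U G a) (l : d) (k : d → ℤ) :
    Continuous fun s => srcProj (fun j => G j s) l k := by
  simp only [srcProj_apply]
  exact continuous_finsetSum _ fun m _ => continuous_const.mul (h.contG m k)

/-- The forcing integrand `s ↦ e^{-νₖ(τ-s)} (P G(s))ₗ(k)` is continuous. [folklore] -/
theorem PicardHypF.continuous_forcing_integrand (h : PicardHypF ν T U G a) (l : d) (k : d → ℤ)
    (τ : ℝ) : Continuous fun s => (heatFactor ν k (τ - s) : ℂ) * srcProj (fun j => G j s) l k :=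
  (continuous_heatFactor_comp (continuous_const.sub continuous_id) ν k).mul (h.continuous_srcProj l k)

/-- **Continuity of the forcing term in time** (parametric interval integrals, Mathlib
`intervalIntegral.continuous_parametric_intervalIntegral_of_continuous`). [folklore] -/
theorem PicardHypF.continuous_forcing (h : PicardHypF ν T U G a) (l : d) (k : d → ℤ) :
    Continuous fun t => forcing ν T G l t k := by
  have hF : Continuous (Function.uncurry fun (t s : ℝ) => (heatFactor ν k (clamp T t - s) : ℂ) *
      srcProj (fun j => G j s) l k) := by
    have hcl : Continuous fun p : ℝ × ℝ => clamp T p.1 - p.2 :=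
      ((FourierNS.continuous_clamp T).comp continuous_fst).sub continuous_snd
    exact (continuous_heatFactor_comp hcl ν k).mul ((h.continuous_srcProj l k).comp continuous_snd)
  exact intervalIntegral.continuous_parametric_intervalIntegral_of_continuous (μ := volume)
    (a₀ := 0) hF (FourierNS.continuous_clamp T)

/-- **Continuity of the forced Duhamel map in time** for `c` continuous in time with uniform
decay of order `2#d + 1`. [folklore] -/
theorem PicardHypF.continuous_picardMapF (h : PicardHypF ν T U G a) {c : d → ℝ → (d → ℤ) → ℂ}
    {X : ℝ} (hc : ∀ l m, Continuous fun t => c l t m) (hcd : ∀ l t, HasDecay (latOrder d + 1) X (c l t))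
    (l : d) (k : d → ℤ) : Continuous fun t => picardMapF ν T U G a c l t k :=
  (h.toPicardHyp.continuous_picardMap hc hcd l k).add (h.continuous_forcing l k)

/-- **Decay of the forcing term**: if every `Gⱼ(t)` decays to order `K` with constant `B ≥ 0`,
then `forcing ν T G (l, t, ·)` decays to order `K` with constant `T · 2#d · B` (the heat factor
is at most one, `ScalarFourier.norm_duhamel_le_const`). [folklore] -/
theorem hasDecay_forcing (hν : 0 ≤ ν) (hT : 0 ≤ T) {K : ℕ} {B : ℝ} (hB0 : 0 ≤ B)
    (hB : ∀ j t, HasDecay K B (G j t)) (l : d) (t : ℝ) :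
    HasDecay K (T * (2 * Fintype.card d * B)) (forcing ν T G l t) := by
  intro k
  have hτ := FourierNS.clamp_mem_Icc hT t
  rw [forcing_apply]
  have hb : ∀ s ∈ Icc 0 (clamp T t), ‖srcProj (fun j => G j s) l k‖ ≤
      2 * Fintype.card d * B * ((1 + ‖k‖) ^ K)⁻¹ := fun s _ => hasDecay_srcProj (fun m => hB m s) l k
  exact (norm_duhamel_le_const (T := T) hν hτ (by positivity) hb k).trans (le_of_eq (by ring))

/-- **The first iterate** `c₁ = Φ_G(0) = e^{-νₖ clamp t} a(l, k) + forcing(l, t, k)`. [folklore] -/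
theorem picardMapF_zero_field (ν T : ℝ) (U G : d → ℝ → (d → ℤ) → ℂ) (a : d → (d → ℤ) → ℂ) (l : d)
    (t : ℝ) (k : d → ℤ) :
    picardMapF ν T U G a (fun _ _ _ => 0) l t k =
      (heatFactor ν k (clamp T t) : ℂ) * a l k + forcing ν T G l t k := by
  rw [picardMapF_apply, picardMap_zero_field]

/-- The first iterate decays to order `K` with the constant `A₀ + T · 2#d · B`. [folklore] -/
theorem PicardHypF.hasDecay_picardMapF_zero (h : PicardHypF ν T U G a) {K : ℕ} {A₀ B : ℝ}
    (ha : ∀ l, HasDecay K A₀ (a l)) (hB0 : 0 ≤ B) (hB : ∀ j t, HasDecay K B (G j t)) (l : d) (t : ℝ) :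
    HasDecay K (A₀ + T * (2 * Fintype.card d * B)) (picardMapF ν T U G a (fun _ _ _ => 0) l t) := by
  intro k
  rw [picardMapF_apply]
  exact norm_add_le_of_le (h.toPicardHyp.hasDecay_picardMap_zero ha l t k)
    (hasDecay_forcing h.hν.le h.hT.le hB0 hB l t k) |>.trans (le_of_eq (by ring))

/-- The first iterate is continuous in time at each component and frequency. [folklore] -/
theorem PicardHypF.continuous_picardMapF_zero (h : PicardHypF ν T U G a) (l : d) (k : d → ℤ) :
    Continuous fun t => picardMapF ν T U G a (fun _ _ _ => 0) l t k :=
  h.continuous_picardMapF (X := 0) (fun _ _ => continuous_const) (fun _ _ => HasDecay.zero _) l k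

end Basic

/-! ### The forcing cancels in differences; the datum -/

section Difference

/-- **Differences of the forced map are differences of the homogeneous map**:
`Φ_G(c₁) - Φ_G(c₂) = Φ(c₁) - Φ(c₂)` — the contraction estimate of
`LinearisedNSFourierPicard` is untouched by the source. [folklore] -/
theorem picardMapF_sub (ν T : ℝ) (U G : d → ℝ → (d → ℤ) → ℂ) (a : d → (d → ℤ) → ℂ)
    (c₁ c₂ : d → ℝ → (d → ℤ) → ℂ) (l : d) (t : ℝ) (k : d → ℤ) :
    picardMapF ν T U G a c₁ l t k - picardMapF ν T U G a c₂ l t k =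
      picardMap ν T U a c₁ l t k - picardMap ν T U a c₂ l t k := by
  rw [picardMapF_apply, picardMapF_apply, add_sub_add_right_eq_sub]

/-- Consecutive differences of the forced iterates are differences of the homogeneous map at
the forced iterates: `cₙ₊₂ - cₙ₊₁ = Φ(cₙ₊₁) - Φ(cₙ)`. [folklore] -/
theorem picardIterF_succ_sub (ν T : ℝ) (U G : d → ℝ → (d → ℤ) → ℂ) (a : d → (d → ℤ) → ℂ) (n : ℕ)
    (l : d) (t : ℝ) (k : d → ℤ) :
    picardIterF ν T U G a (n + 1 + 1) l t k - picardIterF ν T U G a (n + 1) l t k =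
      picardMap ν T U a (picardIterF ν T U G a (n + 1)) l t k -
        picardMap ν T U a (picardIterF ν T U G a n) l t k := by
  show picardMapF ν T U G a (picardIterF ν T U G a (n + 1)) l t k -
    picardMapF ν T U G a (picardIterF ν T U G a n) l t k = _
  exact picardMapF_sub ν T U G a _ _ l t k

/-- The forcing term vanishes at time `0`. [folklore] -/
theorem forcing_zero_time (hT : 0 ≤ T) (l : d) (k : d → ℤ) : forcing ν T G l 0 k = 0 := by
  simp [forcing_apply, FourierNS.clamp_zero hT]

/-- The forced Duhamel map at time `0` returns the datum: `Φ_G(c)(l, 0, k) = a(l, k)`. [folklore] -/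
theorem picardMapF_zero_time (hT : 0 ≤ T) (c : d → ℝ → (d → ℤ) → ℂ) (l : d) (k : d → ℤ) :
    picardMapF ν T U G a c l 0 k = a l k := by
  rw [picardMapF_apply, picardMap_zero_time hT, forcing_zero_time hT, add_zero]

end Difference

/-! ### Divergence freedom and the zero mode of the forcing term -/

section Structure

/-- **The forcing term is Fourier-divergence free**: `∑ₗ kₗ forcing(l, t, k) = 0` (the
integrand is a projected family, `sum_intCast_mul_leray_apply`). [folklore] -/
theorem PicardHypF.sum_intCast_mul_forcing (h : PicardHypF ν T U G a) (t : ℝ) (k : d → ℤ) :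
    ∑ l, (k l : ℂ) * forcing ν T G l t k = 0 := by
  set τ := clamp T t with hτdef
  have hi : ∀ l, IntervalIntegrable (fun s => (heatFactor ν k (τ - s) : ℂ) *
      srcProj (fun j => G j s) l k) volume 0 τ := fun l =>
    (h.continuous_forcing_integrand l k τ).intervalIntegrable _ _
  simp only [forcing_apply, ← hτdef]
  simp_rw [← intervalIntegral.integral_const_mul]
  rw [← intervalIntegral.integral_finsetSum fun l _ => (hi l).const_mul _]
  have hzero : ∀ s, ∑ l, (k l : ℂ) * ((heatFactor ν k (τ - s) : ℂ) *
      srcProj (fun j => G j s) l k) = 0 := by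
    intro s
    have h0 := sum_intCast_mul_leray_apply (fun m => G m s k) k
    calc ∑ l, (k l : ℂ) * ((heatFactor ν k (τ - s) : ℂ) * srcProj (fun j => G j s) l k)
        = (heatFactor ν k (τ - s) : ℂ) * ∑ l, (k l : ℂ) * srcProj (fun j => G j s) l k := by
          rw [Finset.mul_sum]
          refine Finset.sum_congr rfl fun l _ => ?_
          ring
      _ = 0 := by simp only [srcProj_apply]; rw [h0, mul_zero]
  have hfun : (fun s => ∑ l, (k l : ℂ) * ((heatFactor ν k (τ - s) : ℂ) *
      srcProj (fun j => G j s) l k)) = fun _ => 0 := funext hzero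
  rw [hfun, intervalIntegral.integral_zero]

/-- **The forced Duhamel map produces Fourier-divergence-free fields from a
Fourier-divergence-free datum**: `∑ₗ kₗ Φ_G(c)(l, t, k) = 0` for `c` continuous in time with
uniform decay of order `2#d + 1`, if `∑ₗ kₗ a(l, k) = 0`. [folklore] -/
theorem PicardHypF.sum_intCast_mul_picardMapF (h : PicardHypF ν T U G a)
    (hadiv : ∀ k, ∑ l, (k l : ℂ) * a l k = 0) {c : d → ℝ → (d → ℤ) → ℂ} {X : ℝ}
    (hcc : ∀ l m, Continuous fun t => c l t m) (hc : ∀ l t, HasDecay (latOrder d + 1) X (c l t))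
    (t : ℝ) (k : d → ℤ) : ∑ l, (k l : ℂ) * picardMapF ν T U G a c l t k = 0 := by
  simp only [picardMapF_apply, mul_add, Finset.sum_add_distrib,
    h.toPicardHyp.sum_intCast_mul_picardMap hadiv hcc hc t k, h.sum_intCast_mul_forcing t k, add_zero]

/-- At the zero frequency the projected source is the source: `(P(0) G)ₗ = Gₗ(0)`. [folklore] -/
theorem srcProj_zero_freq (G₀ : d → (d → ℤ) → ℂ) (l : d) : srcProj G₀ l 0 = G₀ l 0 := by
  rw [srcProj_apply]
  exact leray_apply_zero_freq (fun m => G₀ m 0) l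

/-- **The forcing term has vanishing zero mode when the source has**: `forcing(l, t, 0) = 0`
if `Gⱼ(s)(0) = 0` for all `j`, `s` (mean-zero source slices; `P(0) = 1`). [folklore] -/
theorem forcing_zero_freq (hG0 : ∀ j s, G j s 0 = 0) (l : d) (t : ℝ) : forcing ν T G l t 0 = 0 := by
  have hz : ∀ s, srcProj (fun j => G j s) l 0 = 0 := fun s =>
    (srcProj_zero_freq (fun j => G j s) l).trans (hG0 l s)
  simp_rw [forcing_apply, hz, mul_zero, intervalIntegral.integral_zero]

end Structure

end LinearisedNSFourier

end Literature.Analysis.FluidPDE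

end
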